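import Summits.AtomisticToContinuum.HydrodynamicLimit.Theses.LambertianContactSwap
import Summits.AtomisticToContinuum.HydrodynamicLimit.Theorems.LambertianContactSwapCollisionMomentBoundRung0
import Summits.AtomisticToContinuum.HydrodynamicLimit.Theorems.JParityClosureCollisionTightnessDomination
import Literature.Analysis.FluidPDE.HardSphereFlowMeasurable
import Literature.MathematicalPhysics.KineticTheory.HardSphereEulerProofs
import HarnessLib

/-!
# Crux `ContactAngleEquidistribution` (stmt-AtomisticToContinuum-12097), line `Sketch`, stub `stub_nearField` — TOOLS
# for the reduction of the near-field balance (admissible normals, admissible-conditioned cosine mean, measurability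
# of marked collision sums over Alexander's construction, per-`N` finiteness of the `|g|³`-weighted count)

Support file (`--supports stmt-AtomisticToContinuum-12097`), imported by
`…Theorems.LambertianContactSwapContactAngleEquidistributionNearField` (the statements `NearFieldBalance` = the registered stub,
`NearFieldAdmissibleCosineLaw`, `NearFieldBlockingIsotropy`, and the reduction `nearFieldBalance_of`). Contents:

* `admissibleNormals ε y i j x` — the ADMISSIBLE NORMALS of the pair `(i, j)` about the midpoint `x`: candidates `n` such that the
  pair re-placed at `x ± (ε/2) n` (all other spheres kept) overlaps no third sphere and stays near-field (a third centre within `2ε`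
  of a collider); `admissibleCosineMean A g φ = κ_g(φ 1_A)/κ_g(A)` with the cosine law `κ_g` sampled exactly as in the crux
  (`n = normalize(−ĝ + ξ̂)`, `ξ ∼ stdGaussian`).
* `NearField.*` — `|admissibleCosineMean| ≤ 1` for `|φ| ≤ 1` (junk cases included); measurability of the admissible-conditioned and
  plain cosine means in measurable parameters (`StronglyMeasurable.integral_prod_right'`), of the `hit` / `near` selectors, of the
  pre-collisional configuration `zpre`, the instants `tcol` and the count `Kt` of Alexander's construction (tree:
  `Alexander.measurable_stateAfter / _freeExitTime / _collisionInstant / _collisionCount`, `Torus.isHardSphereRegular_geometry`,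
  `0 < σ < 1/2`), of sums over `Finset.range (K z)`; the abstract steps `tendsto_integral_of_eq_add`, `integrable_of_abs_le`,
  `abs_mul_sum3_le_two_mul`.
* `stub_nearFieldFinite` (registered sub-goal, PROVED): every local Gibbs expectation of the normalised `|g|³`-weighted collision
  count is finite (`∀ N`; from rung 0 `collisionMomentBound_const` and the domination `exists_localGibbsMeasure_le_smul_const` — the
  route item `CollisionMomentBound` itself, uniform in `N`, is NOT used).

References: C. Cercignani, R. Illner, M. Pulvirenti, *The Mathematical Theory of Dilute Gases* (1994) §2.2, App. 4.A;
I. Gallagher, L. Saint-Raymond, B. Texier, *From Newton to Boltzmann* (2013) Ch. 4; H. Spohn, *Large Scale Dynamics of Interacting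
Particles* (1991) Part I §2.3.
-/

noncomputable section

open MeasureTheory Filter Set Topology ProbabilityTheory
open scoped ENNReal BigOperators Classical

namespace Summit.AtomisticToContinuum.HydrodynamicLimit.Theorems.ContactAngleEquidistributionSketch

open Literature.Analysis.FluidPDE Literature.MathematicalPhysics.KineticTheory
open Summit.AtomisticToContinuum.HydrodynamicLimit.Theses.LambertianContactSwap
open Summit.AtomisticToContinuum.HydrodynamicLimit.Theorems.LambertianContactSwapCollisionMomentBound

/-! ## The admissible normals and the admissible-conditioned cosine mean -/

/-- The ADMISSIBLE NORMALS of the pair `(i, j)` of `y` about the midpoint `x` at diameter `ε`: candidates `n` such that re-placing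
`i` at `x + (ε/2) n` and `j` at `x − (ε/2) n` (other spheres kept) overlaps no third sphere and keeps the pair near-field (a third
centre within `2ε` of one of the two). [cite: CIP1994, App. 4.A pp. 108–111] -/
def admissibleNormals (ε : ℝ) {n : ℕ} (y : Config n (Fin 3) T3) (i j : Fin n) (x : T3) : Set V3 :=
  {ν | (∀ k : Fin n, k ≠ i → k ≠ j →
      ε ≤ ‖(Torus.geometry (Fin 3)).sepVec (y k).1 ((Torus.geometry (Fin 3)).translate x ((ε / 2) • ν))‖ ∧
      ε ≤ ‖(Torus.geometry (Fin 3)).sepVec (y k).1 ((Torus.geometry (Fin 3)).translate x (-((ε / 2) • ν)))‖) ∧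
    ∃ k : Fin n, k ≠ i ∧ k ≠ j ∧
      (‖(Torus.geometry (Fin 3)).sepVec (y k).1 ((Torus.geometry (Fin 3)).translate x ((ε / 2) • ν))‖ ≤ 2 * ε ∨
       ‖(Torus.geometry (Fin 3)).sepVec (y k).1 ((Torus.geometry (Fin 3)).translate x (-((ε / 2) • ν)))‖ ≤ 2 * ε)}

/-- The ADMISSIBLE-CONDITIONED COSINE MEAN `κ_g(φ 1_A)/κ_g(A)` of a mark `φ`, the cosine law `κ_g` sampled exactly as in the crux,
`n = normalize(−ĝ + ξ̂)`, `ξ ∼ stdGaussian` (junk `0` if `κ_g(A) = 0`). [cite: CIP1994, §2.2] -/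
def admissibleCosineMean (A : Set V3) (g : V3) (φ : V3 → ℝ) : ℝ :=
  (∫ ξ, (if ‖‖-g‖⁻¹ • (-g) + ‖ξ‖⁻¹ • ξ‖⁻¹ • (‖-g‖⁻¹ • (-g) + ‖ξ‖⁻¹ • ξ) ∈ A then
      φ (‖‖-g‖⁻¹ • (-g) + ‖ξ‖⁻¹ • ξ‖⁻¹ • (‖-g‖⁻¹ • (-g) + ‖ξ‖⁻¹ • ξ)) else 0) ∂(stdGaussian V3)) /
    (∫ ξ, (if ‖‖-g‖⁻¹ • (-g) + ‖ξ‖⁻¹ • ξ‖⁻¹ • (‖-g‖⁻¹ • (-g) + ‖ξ‖⁻¹ • ξ) ∈ A then (1 : ℝ) else 0) ∂(stdGaussian V3))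

/-! ## Tools: bounds, measurability over Alexander's construction, per-`N` finiteness of the `|g|³`-weighted count -/

namespace NearField

/-- `|x² (a − b)| ≤ 2(1 + x³)` for `x ≥ 0`, `|a|, |b| ≤ 1` (`x² ≤ 1 + x³`). [folklore] -/
theorem abs_sq_mul_sub_le {x a b : ℝ} (hx : 0 ≤ x) (ha : |a| ≤ 1) (hb : |b| ≤ 1) : |x ^ 2 * (a - b)| ≤ 2 * (1 + x ^ 3) := by
  have h2 : x ^ 2 ≤ 1 + x ^ 3 := by
    rcases le_or_gt x 1 with h | h
    · nlinarith [mul_le_one₀ h hx h, pow_nonneg hx 3]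
    · nlinarith [mul_nonneg (sq_nonneg x) (sub_nonneg.2 h.le)]
  rw [abs_mul, abs_pow, abs_of_nonneg hx]
  have hd : |a - b| ≤ 2 := (abs_sub a b).trans (by linarith)
  calc x ^ 2 * |a - b| ≤ x ^ 2 * 2 := by gcongr
    _ ≤ 2 * (1 + x ^ 3) := by linarith

/-- If `∫ f_N → 0`, `∫ g_N → 0`, both integrable and `h_N = f_N + g_N` pointwise, then `∫ h_N → 0`. [folklore] -/
theorem tendsto_integral_of_eq_add {α : ℕ → Type*} [∀ N, MeasurableSpace (α N)] {μ : (N : ℕ) → Measure (α N)}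
    {f g : (N : ℕ) → α N → ℝ} (h : (N : ℕ) → α N → ℝ) (hf : Tendsto (fun N => ∫ z, f N z ∂μ N) atTop (𝓝 0))
    (hg : Tendsto (fun N => ∫ z, g N z ∂μ N) atTop (𝓝 0)) (hfi : ∀ N, Integrable (f N) (μ N))
    (hgi : ∀ N, Integrable (g N) (μ N)) (hh : ∀ N z, h N z = f N z + g N z) :
    Tendsto (fun N => ∫ z, h N z ∂μ N) atTop (𝓝 0) := by
  have H := hf.add hg
  rw [add_zero] at H
  refine H.congr fun N => ?_
  rw [← integral_add (hfi N) (hgi N)]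
  exact integral_congr_ae (ae_of_all _ fun z => (hh N z).symm)

/-- A measurable function dominated by twice a measurable weight of finite `lintegral` is integrable. [folklore] -/
theorem integrable_of_abs_le {α : Type*} [MeasurableSpace α] {μ : Measure α} {F W : α → ℝ}
    (hW : ∫⁻ z, ENNReal.ofReal (W z) ∂μ ≠ ⊤) (hFm : Measurable F) (hWm : Measurable W) (hFW : ∀ z, |F z| ≤ 2 * W z) :
    Integrable F μ := by
  have hW0 : ∀ z, 0 ≤ W z := fun z => by have := (abs_nonneg (F z)).trans (hFW z); linarith
  have hWi : Integrable W μ := ⟨hWm.aestronglyMeasurable, (hasFiniteIntegral_iff_ofReal (ae_of_all _ hW0)).2 hW.lt_top⟩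
  exact (hWi.const_mul 2).mono' hFm.aestronglyMeasurable (ae_of_all _ fun z => by simpa [Real.norm_eq_abs] using hFW z)

/-- A sum over `Finset.range (K z)` of measurable terms, `K` measurable, is measurable. [folklore] -/
theorem measurable_sum_range {α : Type*} [MeasurableSpace α] {K : α → ℕ} (hK : Measurable K) {a : ℕ → α → ℝ}
    (ha : ∀ m, Measurable (a m)) : Measurable fun z => ∑ m ∈ Finset.range (K z), a m z := by
  have h : Measurable fun p : α × ℕ => ∑ m ∈ Finset.range p.2, a m p.1 := by
    refine measurable_from_prod_countable_left fun k => ?_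
    exact Finset.measurable_sum (Finset.range k) fun m _ => ha m
  exact h.comp (measurable_id.prodMk hK)

/-- Termwise domination `|f| ≤ 2g` gives `|c Σ f| ≤ 2 (c Σ g)` for `c ≥ 0`. [folklore] -/
theorem abs_mul_sum3_le_two_mul {ι : Type*} (K : Finset ι) (n : ℕ) {c : ℝ} (hc : 0 ≤ c) (f g : ι → Fin n → Fin n → ℝ)
    (h : ∀ m i j, |f m i j| ≤ 2 * g m i j) :
    |c * ∑ m ∈ K, ∑ i : Fin n, ∑ j : Fin n, f m i j| ≤ 2 * (c * ∑ m ∈ K, ∑ i : Fin n, ∑ j : Fin n, g m i j) := by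
  rw [abs_mul, abs_of_nonneg hc, mul_left_comm, Finset.mul_sum]
  refine mul_le_mul_of_nonneg_left ((Finset.abs_sum_le_sum_abs _ _).trans (Finset.sum_le_sum fun m _ => ?_)) hc
  rw [Finset.mul_sum]
  refine (Finset.abs_sum_le_sum_abs _ _).trans (Finset.sum_le_sum fun i _ => ?_)
  rw [Finset.mul_sum]
  exact (Finset.abs_sum_le_sum_abs _ _).trans (Finset.sum_le_sum fun j _ => h m i j)

/-- `|∫ f dμ| ≤ 1` for a probability measure and `|f| ≤ 1` (no measurability needed). [folklore] -/
theorem abs_integral_le_one {α : Type*} [MeasurableSpace α] (μ : Measure α) [IsProbabilityMeasure μ] {f : α → ℝ}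
    (hf : ∀ x, |f x| ≤ 1) : |∫ x, f x ∂μ| ≤ 1 := by
  simpa [Real.norm_eq_abs] using norm_integral_le_of_norm_le_const (μ := μ) (f := f) (C := 1)
    (ae_of_all _ fun x => by simpa [Real.norm_eq_abs] using hf x)

/-- The Lambert direction `ξ ↦ normalize(−ĝ + ξ̂)` is jointly measurable in `(a, ξ)` for measurable `g(a)`. [folklore] -/
theorem measurable_ldir_neg {α : Type*} [MeasurableSpace α] {g : α → V3} (hg : Measurable g) :
    Measurable fun q : α × V3 => ‖‖-g q.1‖⁻¹ • (-g q.1) + ‖q.2‖⁻¹ • q.2‖⁻¹ • (‖-g q.1‖⁻¹ • (-g q.1) + ‖q.2‖⁻¹ • q.2) := by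
  have h1 : Measurable fun q : α × V3 => -g q.1 := (hg.comp measurable_fst).fun_neg
  have ha : Measurable fun q : α × V3 => ‖-g q.1‖⁻¹ • (-g q.1) + ‖q.2‖⁻¹ • q.2 :=
    (h1.norm.fun_inv.fun_smul h1).fun_add (measurable_snd.norm.fun_inv.fun_smul measurable_snd)
  exact ha.norm.fun_inv.fun_smul ha

/-- `|admissibleCosineMean A g φ| ≤ 1` whenever `|φ| ≤ 1` (junk cases included). [folklore] -/
theorem abs_admissibleCosineMean_le_one (A : Set V3) (g : V3) {φ : V3 → ℝ} (hφ : ∀ n, |φ n| ≤ 1) :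
    |admissibleCosineMean A g φ| ≤ 1 := by
  unfold admissibleCosineMean
  set L : V3 → V3 := fun ξ => ‖‖-g‖⁻¹ • (-g) + ‖ξ‖⁻¹ • ξ‖⁻¹ • (‖-g‖⁻¹ • (-g) + ‖ξ‖⁻¹ • ξ) with hL
  set D : ℝ := ∫ ξ, (if L ξ ∈ A then (1 : ℝ) else 0) ∂(stdGaussian V3) with hD
  by_cases hD0 : D = 0
  · simp [hD0]
  have hgi : Integrable (fun ξ => if L ξ ∈ A then (1 : ℝ) else 0) (stdGaussian V3) := by
    by_contra h; exact hD0 (integral_undef h)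
  have hDpos : 0 < D := lt_of_le_of_ne (integral_nonneg fun ξ => by dsimp only; split_ifs <;> norm_num) (Ne.symm hD0)
  have hnum : |∫ ξ, (if L ξ ∈ A then φ (L ξ) else 0) ∂(stdGaussian V3)| ≤ D := by
    refine abs_integral_le_integral_abs.trans (integral_mono_of_nonneg (ae_of_all _ fun ξ => abs_nonneg _) hgi
      (ae_of_all _ fun ξ => ?_))
    dsimp only
    split_ifs with h
    · exact hφ _
    · simp
  rw [abs_div, abs_of_pos hDpos, div_le_one hDpos]
  exact hnum

/-- Membership of a measurably varying vector in the admissible normals of a measurably varying configuration is a measurable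
condition. [folklore] -/
theorem measurableSet_mem_admissibleNormals {α : Type*} [MeasurableSpace α] (ε : ℝ) {n : ℕ} {y : α → Config n (Fin 3) T3}
    (hy : Measurable y) (i j : Fin n) {x : α → T3} (hx : Measurable x) {ν : α → V3} (hν : Measurable ν) :
    MeasurableSet {a | ν a ∈ admissibleNormals ε (y a) i j (x a)} := by
  have hGm := Torus.isMeasurable_geometry (d := Fin 3)
  have hpos : ∀ k : Fin n, Measurable fun a => (y a k).1 := fun k => (Geometry.IsMeasurable.measurable_pos k).comp hy
  have hsm : Measurable fun a => (ε / 2) • ν a := hν.const_smul (ε / 2)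
  have hp : Measurable fun a => (Torus.geometry (Fin 3)).translate (x a) ((ε / 2) • ν a) :=
    hGm.measurable_translate.comp (hx.prodMk hsm)
  have hm : Measurable fun a => (Torus.geometry (Fin 3)).translate (x a) (-((ε / 2) • ν a)) :=
    hGm.measurable_translate.comp (hx.prodMk hsm.neg)
  have h1 : ∀ k : Fin n, Measurable fun a =>
      ‖(Torus.geometry (Fin 3)).sepVec (y a k).1 ((Torus.geometry (Fin 3)).translate (x a) ((ε / 2) • ν a))‖ :=
    fun k => (hGm.measurable_sepVec.comp ((hpos k).prodMk hp)).norm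
  have h2 : ∀ k : Fin n, Measurable fun a =>
      ‖(Torus.geometry (Fin 3)).sepVec (y a k).1 ((Torus.geometry (Fin 3)).translate (x a) (-((ε / 2) • ν a)))‖ :=
    fun k => (hGm.measurable_sepVec.comp ((hpos k).prodMk hm)).norm
  have hP1 : ∀ k : Fin n, Measurable fun a => k ≠ i → k ≠ j →
      ε ≤ ‖(Torus.geometry (Fin 3)).sepVec (y a k).1 ((Torus.geometry (Fin 3)).translate (x a) ((ε / 2) • ν a))‖ ∧
      ε ≤ ‖(Torus.geometry (Fin 3)).sepVec (y a k).1 ((Torus.geometry (Fin 3)).translate (x a) (-((ε / 2) • ν a)))‖ :=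
    fun k => measurable_const.imp (measurable_const.imp ((measurable_const.le' (h1 k)).and (measurable_const.le' (h2 k))))
  have hP2 : ∀ k : Fin n, Measurable fun a => k ≠ i ∧ k ≠ j ∧
      (‖(Torus.geometry (Fin 3)).sepVec (y a k).1 ((Torus.geometry (Fin 3)).translate (x a) ((ε / 2) • ν a))‖ ≤ 2 * ε ∨
       ‖(Torus.geometry (Fin 3)).sepVec (y a k).1 ((Torus.geometry (Fin 3)).translate (x a) (-((ε / 2) • ν a)))‖ ≤ 2 * ε) :=
    fun k => measurable_const.and (measurable_const.and (((h1 k).le' measurable_const).or ((h2 k).le' measurable_const)))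
  exact measurableSet_setOf.2 ((Measurable.forall hP1).and (Measurable.exists hP2))

/-- Measurability of `a ↦ admissibleCosineMean (admissibleNormals ε (y a) i j (x a)) (g a) (φ a)` for measurable data. [folklore] -/
theorem measurable_admissibleCosineMean {α : Type*} [MeasurableSpace α] (ε : ℝ) {n : ℕ} {y : α → Config n (Fin 3) T3}
    (hy : Measurable y) (i j : Fin n) {x : α → T3} (hx : Measurable x) {g : α → V3} (hg : Measurable g) {φ : α → V3 → ℝ}
    (hφ : Measurable fun q : α × V3 => φ q.1 q.2) :
    Measurable fun a => admissibleCosineMean (admissibleNormals ε (y a) i j (x a)) (g a) (φ a) := by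
  unfold admissibleCosineMean
  have hL := measurable_ldir_neg hg
  have hy' : Measurable fun q : α × V3 => y q.1 := hy.comp measurable_fst
  have hx' : Measurable fun q : α × V3 => x q.1 := hx.comp measurable_fst
  have hA := measurableSet_mem_admissibleNormals ε hy' i j hx' hL
  have hφL : Measurable fun q : α × V3 =>
      φ q.1 (‖‖-g q.1‖⁻¹ • (-g q.1) + ‖q.2‖⁻¹ • q.2‖⁻¹ • (‖-g q.1‖⁻¹ • (-g q.1) + ‖q.2‖⁻¹ • q.2)) := hφ.comp (measurable_fst.prodMk hL)
  have hnum : Measurable fun q : α × V3 =>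
      if ‖‖-g q.1‖⁻¹ • (-g q.1) + ‖q.2‖⁻¹ • q.2‖⁻¹ • (‖-g q.1‖⁻¹ • (-g q.1) + ‖q.2‖⁻¹ • q.2) ∈ admissibleNormals ε (y q.1) i j (x q.1)
      then φ q.1 (‖‖-g q.1‖⁻¹ • (-g q.1) + ‖q.2‖⁻¹ • q.2‖⁻¹ • (‖-g q.1‖⁻¹ • (-g q.1) + ‖q.2‖⁻¹ • q.2)) else 0 :=
    Measurable.ite hA hφL measurable_const
  have hden : Measurable fun q : α × V3 =>
      if ‖‖-g q.1‖⁻¹ • (-g q.1) + ‖q.2‖⁻¹ • q.2‖⁻¹ • (‖-g q.1‖⁻¹ • (-g q.1) + ‖q.2‖⁻¹ • q.2) ∈ admissibleNormals ε (y q.1) i j (x q.1)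
      then (1 : ℝ) else 0 := Measurable.ite hA measurable_const measurable_const
  exact (hnum.stronglyMeasurable.integral_prod_right' (ν := stdGaussian V3)).measurable.fun_div
    (hden.stronglyMeasurable.integral_prod_right' (ν := stdGaussian V3)).measurable

/-- Measurability of the mark `ψ` read at measurable arguments. [folklore] -/
theorem measurable_psiAt {α : Type*} [MeasurableSpace α] {ψ : ℝ → T3 → V3 → V3 → V3 → ℝ}
    (hψ : Measurable fun p : ℝ × T3 × V3 × V3 × V3 => ψ p.1 p.2.1 p.2.2.1 p.2.2.2.1 p.2.2.2.2) {s : α → ℝ} (hs : Measurable s)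
    {x : α → T3} (hx : Measurable x) {v w nn : α → V3} (hv : Measurable v) (hw : Measurable w) (hn : Measurable nn) :
    Measurable fun a => ψ (s a) (x a) (v a) (w a) (nn a) := hψ.comp (hs.prodMk (hx.prodMk (hv.prodMk (hw.prodMk hn))))

/-- Measurability of the cosine mean `∫ ψ(s, x, v, w, normalize(−ĝ + ξ̂)) dγ(ξ)` in the parameters. [folklore] -/
theorem measurable_cosineMean {α : Type*} [MeasurableSpace α] {ψ : ℝ → T3 → V3 → V3 → V3 → ℝ}
    (hψ : Measurable fun p : ℝ × T3 × V3 × V3 × V3 => ψ p.1 p.2.1 p.2.2.1 p.2.2.2.1 p.2.2.2.2) {s : α → ℝ} (hs : Measurable s)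
    {x : α → T3} (hx : Measurable x) {v w g : α → V3} (hv : Measurable v) (hw : Measurable w) (hg : Measurable g) :
    Measurable fun a => ∫ ξ, ψ (s a) (x a) (v a) (w a) (‖‖-g a‖⁻¹ • (-g a) + ‖ξ‖⁻¹ • ξ‖⁻¹ • (‖-g a‖⁻¹ • (-g a) + ‖ξ‖⁻¹ • ξ))
      ∂(stdGaussian V3) := by
  have hF : Measurable fun q : α × V3 => ψ (s q.1) (x q.1) (v q.1) (w q.1)
      (‖‖-g q.1‖⁻¹ • (-g q.1) + ‖q.2‖⁻¹ • q.2‖⁻¹ • (‖-g q.1‖⁻¹ • (-g q.1) + ‖q.2‖⁻¹ • q.2)) :=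
    measurable_psiAt hψ (hs.comp measurable_fst) (hx.comp measurable_fst) (hv.comp measurable_fst) (hw.comp measurable_fst)
      (measurable_ldir_neg hg)
  exact (hF.stronglyMeasurable.integral_prod_right' (ν := stdGaussian V3)).measurable

/-- Velocities, separation and midpoint of a measurably varying configuration are measurable. [folklore] -/
theorem measurable_vel' {α : Type*} [MeasurableSpace α] {n : ℕ} {y : α → Config n (Fin 3) T3} (hy : Measurable y) (k : Fin n) :
    Measurable fun a => (y a k).2 := (Geometry.IsMeasurable.measurable_vel k).comp hy

/-- The separation vector of a pair of a measurably varying configuration is measurable. [folklore] -/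
theorem measurable_sepVec' {α : Type*} [MeasurableSpace α] {n : ℕ} {y : α → Config n (Fin 3) T3} (hy : Measurable y) (i j : Fin n) :
    Measurable fun a => (Torus.geometry (Fin 3)).sepVec (y a i).1 (y a j).1 := (Torus.isMeasurable_geometry.measurable_sepVec_config i j).comp hy

/-- The midpoint `x_j + ½ sepVec(x_i, x_j)` of a pair of a measurably varying configuration is measurable. [folklore] -/
theorem measurable_xmid' {α : Type*} [MeasurableSpace α] {n : ℕ} {y : α → Config n (Fin 3) T3} (hy : Measurable y) (i j : Fin n) :
    Measurable fun a => (Torus.geometry (Fin 3)).translate (y a j).1 ((2 : ℝ)⁻¹ • (Torus.geometry (Fin 3)).sepVec (y a i).1 (y a j).1) := by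
  have h2 : Measurable fun a => (2 : ℝ)⁻¹ • (Torus.geometry (Fin 3)).sepVec (y a i).1 (y a j).1 := (measurable_sepVec' hy i j).const_smul ((2 : ℝ)⁻¹)
  exact Torus.isMeasurable_geometry.measurable_translate.comp (((Geometry.IsMeasurable.measurable_pos j).comp hy).prodMk h2)

/-- The `hit` selector is a measurable condition of a measurably varying configuration. [folklore] -/
theorem measurableSet_hit {α : Type*} [MeasurableSpace α] (ε : ℝ) {n : ℕ} {y : α → Config n (Fin 3) T3} (hy : Measurable y) (i j : Fin n) :
    MeasurableSet {a | i < j ∧ y a ∈ contactSet (Torus.geometry (Fin 3)) n ε i j ∧ IsIncoming (Torus.geometry (Fin 3)) (y a) i j} := by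
  have hGm := Torus.isMeasurable_geometry (d := Fin 3)
  have h1 : MeasurableSet {a | y a ∈ contactSet (Torus.geometry (Fin 3)) n ε i j} :=
    (measurableSet_contactSet _ hGm.measurable_sepVec n ε i j).preimage hy
  have h2 : MeasurableSet {a | IsIncoming (Torus.geometry (Fin 3)) (y a) i j} := (hGm.measurableSet_isIncoming i j).preimage hy
  exact measurableSet_setOf.2 (measurable_const.and ((measurableSet_setOf.1 h1).and (measurableSet_setOf.1 h2)))

/-- The `near` selector is a measurable condition of a measurably varying configuration. [folklore] -/
theorem measurableSet_near {α : Type*} [MeasurableSpace α] (ε : ℝ) {n : ℕ} {y : α → Config n (Fin 3) T3} (hy : Measurable y) (i j : Fin n) :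
    MeasurableSet {a | ∃ k : Fin n, k ≠ i ∧ k ≠ j ∧
      (‖(Torus.geometry (Fin 3)).sepVec (y a k).1 (y a i).1‖ ≤ 2 * ε ∨ ‖(Torus.geometry (Fin 3)).sepVec (y a k).1 (y a j).1‖ ≤ 2 * ε)} := by
  have hs : ∀ k l : Fin n, Measurable fun a => ‖(Torus.geometry (Fin 3)).sepVec (y a k).1 (y a l).1‖ :=
    fun k l => (measurable_sepVec' hy k l).norm
  exact measurableSet_setOf.2 (Measurable.exists fun k => measurable_const.and (measurable_const.and
    (((hs k i).le' measurable_const).or ((hs k j).le' measurable_const))))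

section Alexander

variable {σ : ℝ} (hσ : 0 < σ) (hσ2 : σ < 2⁻¹) (N : ℕ)
include hσ hσ2

/-- The pre-collisional configuration of the `m`-th collision is a measurable function of the datum (`0 < σ < 1/2`). [folklore] -/
theorem measurable_zpre (m : ℕ) :
    Measurable fun z : Config (N + 1) (Fin 3) T3 =>
      freeFlight (Torus.geometry (Fin 3)) (Alexander.freeExitTime (Torus.geometry (Fin 3)) (hsDiameter σ N)
        (Alexander.stateAfter (Torus.geometry (Fin 3)) (hsDiameter σ N) z m)).toReal
        (Alexander.stateAfter (Torus.geometry (Fin 3)) (hsDiameter σ N) z m) := by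
  have hG := Torus.isHardSphereRegular_geometry (d := Fin 3) ((hsDiameter_le hσ.le N).trans_lt hσ2)
  have hGm := Torus.isMeasurable_geometry (d := Fin 3)
  have hst := Alexander.measurable_stateAfter (N := N + 1) hG hGm m
  have hτ : Measurable fun z : Config (N + 1) (Fin 3) T3 => (Alexander.freeExitTime (Torus.geometry (Fin 3)) (hsDiameter σ N)
      (Alexander.stateAfter (Torus.geometry (Fin 3)) (hsDiameter σ N) z m)).toReal :=
    ((Alexander.measurable_freeExitTime hG hGm).comp hst).ennreal_toReal
  exact hGm.measurable_freeFlight₂.comp (hτ.prodMk hst)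

/-- The `(m+1)`-st collision instant is a measurable function of the datum. [folklore] -/
theorem measurable_tcol (m : ℕ) : Measurable fun z : Config (N + 1) (Fin 3) T3 =>
    (Alexander.collisionInstant (Torus.geometry (Fin 3)) (hsDiameter σ N) z (m + 1)).toReal :=
  (Alexander.measurable_collisionInstant (Torus.isHardSphereRegular_geometry (d := Fin 3) ((hsDiameter_le hσ.le N).trans_lt hσ2))
    Torus.isMeasurable_geometry (m + 1)).ennreal_toReal

/-- The collision count in `[0, t]` is a measurable function of the datum. [folklore] -/
theorem measurable_Kt (t : ℝ) : Measurable fun z : Config (N + 1) (Fin 3) T3 =>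
    Alexander.collisionCount (Torus.geometry (Fin 3)) (hsDiameter σ N) z t :=
  Alexander.measurable_collisionCount (Torus.isHardSphereRegular_geometry (d := Fin 3) ((hsDiameter_le hσ.le N).trans_lt hσ2))
    Torus.isMeasurable_geometry t

end Alexander

end NearField

/-! ## Registered sub-goal `stub_nearFieldFinite`: per-`N` finiteness of the `|g|³`-weighted collision count under local Gibbs data -/

/-- STUB `nearFieldFinite` (registered sub-goal of `stub_nearField`, line `Sketch`, crux ContactAngleEquidistribution; PROVED):
**every local Gibbs expectation of the normalised `|g|³`-weighted collision count is finite** (`∀ N`; the route item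
`CollisionMomentBound` asks the bound uniform in `N` and is not used). Rung 0 `collisionMomentBound_const` under the homogeneous
Gibbs law and the domination `localGibbsMeasure σ a₀ u₀ θ₀ N ≤ Λ^{N+1} • localGibbsMeasure σ 1 0 θ₁ N`. [folklore]
-- adapted from `…Theorems.LambertianContactSwapCollisionMomentBoundPointwise.collisionMomentBound_pointwise` -/
theorem stub_nearFieldFinite :
    let Cfg : ℕ → Type := fun N => Config (N + 1) (Fin 3) T3
    let G := Torus.geometry (Fin 3)
    let ε : ℝ → ℕ → ℝ := hsDiameter
    let τ : ℝ → (N : ℕ) → Cfg N → ℝ≥0∞ := fun σ N z => Alexander.freeExitTime G (ε σ N) z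
    let S : ℝ → (N : ℕ) → Cfg N → Cfg N := fun t _ z => freeFlight G t z
    let zpre : ℝ → (N : ℕ) → Cfg N → ℕ → Cfg N := fun σ N z m => let y := Alexander.stateAfter G (ε σ N) z m; S (τ σ N y).toReal N y
    let Kt : ℝ → (N : ℕ) → Cfg N → ℝ → ℕ := fun σ N z t => Alexander.collisionCount G (ε σ N) z t
    let hit : ℝ → (N : ℕ) → Cfg N → Fin (N + 1) → Fin (N + 1) → Prop := fun σ N y i j =>
      i < j ∧ y ∈ contactSet G (N + 1) (ε σ N) i j ∧ IsIncoming G y i j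
    ∀ (a₀ θ₀ : T3 → ℝ) (u₀ : T3 → V3), Continuous a₀ → Continuous θ₀ → Continuous u₀ → (∀ x, 0 < a₀ x) → (∀ x, 0 < θ₀ x) →
      ∃ σ₀ : ℝ, 0 < σ₀ ∧ ∀ σ : ℝ, 0 < σ → σ < σ₀ → ∀ Φ : (N : ℕ) → HardSphereFlow G (ε σ N) (N + 1),
      let P := fun N => localGibbsLaw σ a₀ u₀ θ₀ N (Φ N)
      ∀ t : ℝ, 0 ≤ t → ∀ N : ℕ,
        ∫⁻ z, ENNReal.ofReal (((N : ℝ) + 1) ^ (-(4 / 3 : ℝ)) * ∑ m ∈ Finset.range (Kt σ N z t), ∑ i : Fin (N + 1), ∑ j : Fin (N + 1),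
          (let y := zpre σ N z m; if hit σ N y i j then 1 + ‖(y i).2 - (y j).2‖ ^ 3 else 0)) ∂(P N) ≠ ⊤ := by
  dsimp (config := { zeta := true }) only
  intro a₀ θ₀ u₀ ha hθ hu ha0 hθ0
  obtain ⟨θ₁, hθ₁, Λ, hΛ, hdom⟩ := exists_localGibbsMeasure_le_smul_const ha hθ hu ha0 hθ0
  obtain ⟨σ₀, hσ₀, hrung⟩ := collisionMomentBound_const one_pos hθ₁ (0 : V3)
  refine ⟨min σ₀ (1 / 2), lt_min hσ₀ (by norm_num), fun σ hσ hσlt Φ t ht N => ?_⟩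
  obtain ⟨C₀, hC₀⟩ := hrung σ hσ (hσlt.trans_le (min_le_left _ _)) Φ t ht
  have hle : localGibbsLaw σ a₀ u₀ θ₀ N (Φ N) ≤ ENNReal.ofReal (Λ ^ (N + 1)) • localGibbsLaw σ (fun _ => 1) (fun _ => (0 : V3)) (fun _ => θ₁) N (Φ N) := by
    rw [localGibbsLaw_eq, localGibbsLaw_eq]
    exact hdom σ (hσlt.trans_le (min_le_right _ _)).le N
  have hfin : ENNReal.ofReal (Λ ^ (N + 1)) * ENNReal.ofReal C₀ ≠ ⊤ := ENNReal.mul_ne_top ENNReal.ofReal_ne_top ENNReal.ofReal_ne_top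
  refine ne_top_of_le_ne_top hfin ((lintegral_mono' hle le_rfl).trans ?_)
  rw [lintegral_smul_measure]
  exact mul_le_mul' le_rfl (hC₀ N)

end Summit.AtomisticToContinuum.HydrodynamicLimit.Theorems.ContactAngleEquidistributionSketch

end
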